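import Summits.BirchSwinnertonDyer.BirchSwinnertonDyer.Theorems.ConjSpanGenAllLevels
import Literature.NumberTheory.Automorphic.CongruenceSubgroupPropertySL2AwayHolds
import Summits.BirchSwinnertonDyer.BirchSwinnertonDyer.Theorems.PrintX8VerticalStevensCollapse
import Summits.BirchSwinnertonDyer.BirchSwinnertonDyer.Theorems.PrintX8VerticalStevensSpan
import HarnessLib

/-!
# Route `PrintX8VS`, cell `bsd-print-x8` (D-0131 (2) print tier), (W-α): THEOREM B of the cell,
# CLASS-WIDE and INPUT-FREE — on every X8 pair ONE colour `col₀ ∈ {♯, ♭}` has `L^{col₀} ≠ 0`,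
# `μ(L^{col₀}) = 0`, unit content and `μ(Λ/(L^{col₀})) = 0`
# (prover seat p1 g5; `--supports` stmt-BirchSwinnertonDyer-19875, closes nothing)

PARTITION (leaf `ClassX8` = `p = 3` good supersingular with `a_3 = ±3`): this file COMPOSES four tree
theorems, all already landed, into the hypothesis-free class-wide statement the crux chain on K1
`SprungLowerDivisibilityAtThree` (stmt-BirchSwinnertonDyer-19875) cites BY NAME as
`ClassX8.oneColourMuAn` / `ClassX8.oneColour_unitContent`:

* `ConjSpanGenAllLevels.conjSpanGenAll_of_vaserstein_away` applied to Vaserstein's relative theorem over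
  `ℤ[1/m]`, `SL2Rel.Away.relG_le_relE_span_natCast` — SPAN `ConjSpanGen M 3` at every level `M` prime to
  `3`, unconditionally (this is the proof term of `PrintX8VSConjSpanGenAll.conjSpanGen_holds`, p576172,
  re-spelt here over route-independent modules so that this file sits outside the Theses cone);
* `Rank1Residual.eisSpanModGen_of_conjSpanGen` — `ConjSpanGen ⟹ EisSpanModGen` (monotonicity);
* `PrintX8VerticalStevens.cycWindingNonConstantX8_of_spanModAtThree` — VS-0 (mod 3) ⟹ VS-1⁺: on all of
  class X8 the winding symbol `x ↦ [x]⁺_f` of the newform is non-constant modulo `3` on `ℤ[1/3]`;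
* `PrintX8VerticalStevensCollapse.oneColourMuAn_of_cycWindingNonConstantX8` — VS-1⁺ ⟹ one colour with
  `L^{col₀} ≠ 0`, `μ = 0`, unit content, `μ(Λ/(L^{col₀})) = 0` on every X8 pair (Sprung 2017 Cor. 4.10 /
  Thm. 1.12 integrally + the Mazur–Tate collapse at `3`).

No image hypothesis (`¬ Surj` / `Surj`), no rank hypothesis, no held input and no named-fact hypothesis
is used: the statement below is exactly the conclusion of `oneColourMuAn_of_cycWindingNonConstantX8`
with its binder `hVS` discharged.  The proof term was kernel-checked independently by the cell referee
(ref g12, probe R-124 (P1), sha16 8e6dd95e8b000b7b) before this landing.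

What it does NOT give: BOTH colours (item 20714 An), nor any divisibility `L^• ∣ char X^•` — K1
(stmt-BirchSwinnertonDyer-19875) stays OPEN; the Birch–Swinnerton-Dyer formula on leaf X8 is NOT
proved by this file.  beyond-print: yes (THEOREM B is not in print at `a_3 = ±3`; modest).

References: [Pollack2003] Def. 6.15; [Sprung2017] Cor. 4.10, Thm. 1.12; [Manin1972] Prop. 1.4;
[Vaserstein1972SL2] Theorem (p. 313); files `Theorems/ConjSpanGenAllLevels.lean`,
`Literature/NumberTheory/Automorphic/CongruenceSubgroupPropertySL2AwayHolds.lean`,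
`Theorems/PrintX8VSConjSpanGenAll.lean` (p576172), `Theorems/PrintX8VerticalStevensSpan.lean`,
`Theorems/PrintX8VerticalStevensCollapse.lean`.
-/

set_option autoImplicit false
-- justification: the mandated namespace `Summit.BirchSwinnertonDyer.BirchSwinnertonDyer.Theorems`
-- (single-conjunct summit, Sub = Summit) repeats a segment by design (D-0017).
set_option linter.dupNamespace false

noncomputable section

open scoped Classical MatrixGroups ModularForm

open CongruenceSubgroup WeierstrassCurve Literature.NumberTheory.Automorphic
  Literature.NumberTheory.EllipticCurves Literature.NumberTheory.EllipticCurves.ModularForms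
  Literature.NumberTheory.EllipticCurves.Sprung2017
  Literature.NumberTheory.EllipticCurves.Rank1Residual
  Literature.NumberTheory.EllipticCurves.GreenbergVatsal2000
  Summit.BirchSwinnertonDyer.Rank1Residual.X1.MuLambda
  Summit.BirchSwinnertonDyer.BirchSwinnertonDyer.Theorems.PrintX8VerticalStevensCollapse
  Summit.BirchSwinnertonDyer.BirchSwinnertonDyer.Theorems.PrintX8VerticalStevens
  Summit.BirchSwinnertonDyer.BirchSwinnertonDyer.Theorems

namespace Summit.BirchSwinnertonDyer.BirchSwinnertonDyer.Theorems.PrintX8VSOneColourMuAnX8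

/-- **VS-1⁺ `CycWindingNonConstantX8` holds, input-free**: on every curve of class X8 (`p = 3`, good
supersingular, `a_3 = ±3`; ANY `3`-adic image, any rank) the cyclotomic winding symbol of the newform is
non-constant modulo `3` on `ℤ[1/3]` (`CycWindingNonConstantAt W p`) — SPAN `ConjSpanGen M 3` at every
level `M` prime to `3` (`conjSpanGenAll_of_vaserstein_away relG_le_relE_span_natCast`, the proof term of
`PrintX8VSConjSpanGenAll.conjSpanGen_holds`, p576172), pushed through `eisSpanModGen_of_conjSpanGen` and
`cycWindingNonConstantX8_of_spanModAtThree`. [cite: Manin1972, Prop. 1.4]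
[cite: Vaserstein1972SL2, Theorem (p. 313)] [cite: Pollack2003, Def. 6.15] -/
theorem ClassX8.cycWindingNonConstant :
    ∀ (W : WeierstrassCurve ℚ) [W.IsElliptic] [W.IsGloballyMinimal] (p : ℕ) [Fact p.Prime],
      ClassX8 W p → CycWindingNonConstantAt W p :=
  cycWindingNonConstantX8_of_spanModAtThree fun M _ h3M ↦ eisSpanModGen_of_conjSpanGen
    (ConjSpanGenAllLevels.conjSpanGenAll_of_vaserstein_away SL2Rel.Away.relG_le_relE_span_natCast
      M 3 Nat.prime_three h3M)

/-- **THEOREM B (x8 cell), class-wide and input-free**: on every X8 pair — `E = W` in class X8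
(`p = 3`, good supersingular, `a_3 = ±3`; ANY `3`-adic image, any rank), `f` its newform, `(L♯, L♭)`
ANY Sprung pair — ONE colour `col₀ ∈ {♯, ♭}` has `L^{col₀} ≠ 0`, `μ(L^{col₀}) = 0`, unit content, and
`μ(Λ/(L^{col₀})) = 0`.  This is the conclusion of `oneColourMuAn_of_cycWindingNonConstantX8` with its
binder `hVS` (VS-1⁺) discharged by `ClassX8.cycWindingNonConstant` (SPAN ∘ `eisSpanModGen_of_conjSpanGen`
∘ `cycWindingNonConstantX8_of_spanModAtThree`); no image hypothesis, no held input.  It does NOT give both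
colours and proves no divisibility: K1 (stmt-BirchSwinnertonDyer-19875) and BSD on leaf X8 stay open.
[cite: Pollack2003, Def. 6.15] [cite: Sprung2017, Cor. 4.10 and Thm. 1.12] [cite: Manin1972, Prop. 1.4]
[cite: Vaserstein1972SL2, Theorem (p. 313)] -/
theorem ClassX8.oneColourMuAn :
    ∀ (W : WeierstrassCurve ℚ) [W.IsElliptic] [W.IsGloballyMinimal] (p : ℕ) [Fact p.Prime],
      ClassX8 W p →
      ∀ (N : ℕ) (_ : NeZero N) (f : CuspForm (Gamma0 N) 2) (Lsharp Lflat : IwasawaAlgebra p),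
      IsNewformOf W f → IsSprungPair f p (W.frobeniusTrace p) Lsharp Lflat →
      ∃ col₀ : Chroma, chromaticL col₀ Lsharp Lflat ≠ 0 ∧ mu (chromaticL col₀ Lsharp Lflat) = 0 ∧
        HasUnitContent (chromaticL col₀ Lsharp Lflat) ∧
        muInvariant p (IwasawaAlgebra p ⧸ Ideal.span {chromaticL col₀ Lsharp Lflat}) = 0 :=
  oneColourMuAn_of_cycWindingNonConstantX8
    fun W _ _ p _ hX _ _ f hf ↦ ClassX8.cycWindingNonConstant W p hX f hf

/-- **THEOREM B, unit-content projection** (the form wanted verbatim by the crux chain on K1 19875,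
card `trianguline-ribet` S3 / card #6 `stub_transport`): on every X8 pair ONE colour `col₀` has
`L^{col₀} ≠ 0` with unit content (`HasUnitContent (L^{col₀})`), input-free — a projection of
`ClassX8.oneColourMuAn`. [cite: Pollack2003, Def. 6.15] [cite: Sprung2017, Cor. 4.10 and Thm. 1.12] -/
theorem ClassX8.oneColour_unitContent :
    ∀ (W : WeierstrassCurve ℚ) [W.IsElliptic] [W.IsGloballyMinimal] (p : ℕ) [Fact p.Prime],
      ClassX8 W p →
      ∀ (N : ℕ) (_ : NeZero N) (f : CuspForm (Gamma0 N) 2) (Lsharp Lflat : IwasawaAlgebra p),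
      IsNewformOf W f → IsSprungPair f p (W.frobeniusTrace p) Lsharp Lflat →
      ∃ col₀ : Chroma, chromaticL col₀ Lsharp Lflat ≠ 0 ∧ HasUnitContent (chromaticL col₀ Lsharp Lflat) := by
  intro W _ _ p _ hX N hN f Lsharp Lflat hf hSP
  obtain ⟨col₀, hne, -, hU, -⟩ := ClassX8.oneColourMuAn W p hX N hN f Lsharp Lflat hf hSP
  exact ⟨col₀, hne, hU⟩

end Summit.BirchSwinnertonDyer.BirchSwinnertonDyer.Theorems.PrintX8VSOneColourMuAnX8

end
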